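import Summits.MatrixMultiplication.OmegaCensus.DominoZpZpKit
import HarnessLib

/-!
# Plane refutation data for `(1,9,12)@325`, hole class `σ = 0`

ω-census `pub-omega`, family (b3), seat pub-omega-group gen 37 (staged for the successor).  Framing: lottery ticket; floor = certified
bounds/negative ranges.  VALUE: finite data / kernel computations of the `ℤ₅²` stage of the census cell `(1,9,12)@325` of `ℤ₅ × ℤ₆₅`
(design `HOME/pub-omega-group-g37/DESIGN-1-9-12.md`); UNTRUSTED data re-checked by the kernel where used; NOT progress on ω.
Entries `(k, (u₀, N, S, y + S))`: for the exception `k` one integer row of `N·M⁻¹` (`refuteRowOK1`) — 0 entries; the other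
160 exceptions of this class are pinned (`DominoZ5Z5Pins19S0*.lean`).
-/

namespace Summit.MatrixMultiplication.OmegaCensus

namespace Z5Z5ThreeSet

/-- Refutation rows, hole class `0` (untrusted). [folklore] -/
def refute19s0 : List (ℕ × (ℕ × ℕ × ℕ × List ℕ)) := []

end Z5Z5ThreeSet

end Summit.MatrixMultiplication.OmegaCensus
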